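import Summits.QuantumFields.BalabanUV.Beta.EriceRemainderEnclosureHistoryAutonomyComparisonAgeComposition

/-!
# EriceRemainderEnclosureHistoryAutonomyComparisonAgeCompositionDecayRoute — (E83i) THE DECAY ROUTE TO (MONO): the old reads of the young drops are
# non-increasing in the pin as soon as «ENTERING WEIGHT × young drop one window deeper ≤ LEAVING WEIGHT × young drop» — no row-mass monotonicity of the old
# kernel ((S-a)) and no monotonicity of the drops; for a ONE-LAG young age the two drops are sandwiched by STATIC data (young coefficients, the per-pin
# growth factors of the old surplus), giving the static family (S-d) that replaces (S-a) in route (N)'s END ((E83j))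

Cell `pub-balaban`, β-function sub-cell, BINDER row D4 «RemainderConst leaves for Bałaban's split» (`HOME/BINDER-OWNERS.md`; owner lineage `b2b-balaban-beta-an4`;
this file by co-owner #2 lineage `b2b-balaban-beta-d4-p2`, generation 74), β-FLOW TEAM duty (1), FREEZE (0) honoured (def-free; imports (E71a) `…AgeComposition`
and uses `read_nonneg`, `read_le_read`, `sol_nonneg_le_of_supersol` BY NAME; §1 is (E81e) `read_antitone_of_decay` with the criterion in product form).

HONEST FRAMING (page 1, verbatim and binding).  *"Discharging BetaPertH makes Bałaban's UV stability UNCONDITIONAL — a real constructive-QFT result; it is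
NOT the continuum limit and NOT the Clay problem."*  THIS FILE DISCHARGES NOTHING OF THE KIND.  Elementary real algebra about ABSTRACT triangular renewal
systems — hypotheses of a census, not facts; the age profile of Bałaban's (1.22) limit functional is NOT PRINTED ([I] p. 298; GAPS G-t4-U2-1∕-2) and NOT
asserted.  Row D4 class UNCHANGED (critical-path width 0; instance 0∕1; D4 DISCHARGE NO DATE).  HONEST DEPENDENCY: continuum YM on T⁴ ⇐ BetaPertH ∧ nine
spine estimates (0/9 proved); BetaPertH ⇐ (D1) ∧ (D4) ∧ CAP+tail; G-an2-4 gates asym, D1 and NE2/3/4.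

THE POINT (census sense (α); route (N); README `HOME/b2b-balaban-beta-d4-p2/g74/e83/README.md` §4 (1) → done here).  At a level `i` of the joint induction
the composition principle needs (MONO): the reads by every OLDER kernel `KL k` (`k > i`) of the YOUNG DROPS `d = RL i (SL i (SA (i+1) w))` are non-increasing
in the pin.  (E81c)∕(E83g) take it from cumulative domination of `KL k` — (S-a), the damped row mass non-increasing in the pin — which g72 found thin for far
old ages and FALSE by 0.08 % at k = 300 for an adversarial relaxed damping.  §1 **`read_antitone_of_entering_decay`** ((E81e) §2 in product form): with
shift domination inside the window, `R d (n+1) ≤ R d n` as soon as **`K (n+1) (k−1)·d (n+1+k) ≤ K n 0·d (n+1)`** — nothing about row masses, nothing about the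
monotonicity of `d`.  §2: for a ONE-LAG young kernel (`KL i m l = 0`, `l ≥ 1`) and an old surplus `v ≥ 0` with KEY (`RL i v ≤ v`) and per-pin growth
`v (p+1) ≤ Hg p·v p` (`Hg ≥ 0`), the young drops are sandwiched by static data: **`young_drop_ge`** `d (m+1) ≥ KL i (m+1) 0·(1 − KL i (m+2) 0·Hg (m+2))·v (m+2)`,
**`young_drop_le`** `d (m+1+y) ≤ KL i (m+1+y) 0·(Π_{p∈[m+2,m+2+y)} Hg p)·v (m+2)`.  §3 **`old_read_antitone_of_static_decay`**: hence the STATIC inequality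
**(S-d)  `KL k (m+1) (y_k−1)·KL i (m+1+y_k) 0·Π_{p∈[m+2,m+2+y_k)} Hg p ≤ KL k m 0·KL i (m+1) 0·(1 − KL i (m+2) 0·Hg (m+2))`** gives (MONO) for the pair
`(i, k)` at the pin `m`.  NUMERICS OF RECORD (`g74/numerics/o9.py`, `o10.py`; two-age flows {1,k}, k ≤ 16, five load regimes from young-minor to
young-saturated, damping classes one∕self∕lower and the adversarial relaxed pattern): the exact (MONO) never fails; the dynamic criterion of §1 has ratio
≤ 0.83; the static (S-d) ≤ 0.845 (worst deep in the ultraviolet, lower class; ≤ 0.70 at the adversarial pins, 0.10–0.39 at the pin) — against (S-a)'s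
0.96–0.999 and its adversarial failures at long windows.  NOT CLAIMED: (S-d) along flows (successor); anything printed.

WHAT IS PROVED ([folklore]; 0 `def`, 0 sorry).  §1 **`read_antitone_of_entering_decay`**.  §2 `onelag_read`, `growth_chain`, **`young_drop_ge`**, **`young_drop_le`**.
§3 **`old_read_antitone_of_static_decay`**.
-/
noncomputable section
open Finset

namespace Summit.QuantumFields.BalabanUV.Beta.EriceRemainderEnclosureHistoryAutonomyComparisonAgeCompositionDecayRoute

open Summit.QuantumFields.BalabanUV.Beta.EriceRemainderEnclosureHistoryAutonomyComparisonAgeComposition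

/-! ## §1 Reads of an input whose entering value is dominated -/

/-- **READS NON-INCREASING FROM THE ENTERING TERM** ((E81e) `read_antitone_of_decay`, product form).  Non-negative kernel on the horizon `N` supported in the
lags `< k` (`1 ≤ k ≤ N`) with shift domination inside the window; `d ≥ 0`; and `K (n+1) (k−1)·d (n+1+k) ≤ K n 0·d (n+1)`.  Then `R d (n+1) ≤ R d n`. [folklore] -/
theorem read_antitone_of_entering_decay {N k : ℕ} {K : ℕ → ℕ → ℝ} {R : (ℕ → ℝ) → ℕ → ℝ}
    (hR : ∀ v n, R v n = ∑ l ∈ range N, K n l * v (n + 1 + l)) (hKk : ∀ n l, k ≤ l → K n l = 0) (hk : 1 ≤ k) (hkN : k ≤ N)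
    (hshift : ∀ n l, l + 1 < k → K (n + 1) l ≤ K n (l + 1))
    {d : ℕ → ℝ} (hd0 : ∀ m, 0 ≤ d m) {n : ℕ} (hcrit : K (n + 1) (k - 1) * d (n + 1 + k) ≤ K n 0 * d (n + 1)) :
    R d (n + 1) ≤ R d n := by
  obtain ⟨k', rfl⟩ : ∃ k', k = k' + 1 := ⟨k - 1, by omega⟩
  have hres : ∀ n' (v : ℕ → ℝ), R v n' = ∑ l ∈ range (k' + 1), K n' l * v (n' + 1 + l) := by
    intro n' v
    rw [hR, ← sum_range_add_sum_Ico _ hkN, sum_eq_zero (s := Ico (k' + 1) N) fun l hl => by rw [hKk n' l (mem_Ico.mp hl).1, zero_mul], add_zero]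
  rw [hres, hres, sum_range_succ (fun l => K (n + 1) l * d (n + 1 + 1 + l)) k', sum_range_succ' (fun l => K n l * d (n + 1 + l)) k']
  have h1 : ∑ l ∈ range k', K (n + 1) l * d (n + 1 + 1 + l) ≤ ∑ l ∈ range k', K n (l + 1) * d (n + 1 + (l + 1)) :=
    sum_le_sum fun l hl => by
      rw [show n + 1 + 1 + l = n + 1 + (l + 1) by ring]
      exact mul_le_mul_of_nonneg_right (hshift n l (by have := mem_range.mp hl; omega)) (hd0 _)
  rw [Nat.add_sub_cancel] at hcrit
  rw [show n + 1 + 1 + k' = n + 1 + (k' + 1) by ring, add_zero]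
  linarith

/-! ## §2 A one-lag young age: its drops sandwiched by static data -/

section OneLag

variable {N : ℕ} {Ky : ℕ → ℕ → ℝ} {Ry Sy : (ℕ → ℝ) → ℕ → ℝ}

/-- A one-lag kernel reads one value: `Ry u m = Ky m 0 · u (m+1)` (`1 ≤ N`). [folklore] -/
theorem onelag_read (hRy : ∀ v n, Ry v n = ∑ l ∈ range N, Ky n l * v (n + 1 + l)) (hK1 : ∀ n l, 1 ≤ l → Ky n l = 0) (hN : 1 ≤ N)
    (u : ℕ → ℝ) (m : ℕ) : Ry u m = Ky m 0 * u (m + 1) := by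
  rw [hRy, sum_eq_single_of_mem 0 (mem_range.mpr (by omega)) fun l _ hl => by rw [hK1 m l (by omega), zero_mul], add_zero]

/-- Per-pin growth chained across a window: `v (p + y) ≤ (Π_{q∈[p,p+y)} Hg q)·v p` for `Hg ≥ 0`. [folklore] -/
theorem growth_chain {v Hg : ℕ → ℝ} (hH0 : ∀ m, 0 ≤ Hg m) (hgrow : ∀ p, v (p + 1) ≤ Hg p * v p) (p y : ℕ) :
    v (p + y) ≤ (∏ q ∈ Ico p (p + y), Hg q) * v p := by
  induction y with
  | zero => simp
  | succ y ih =>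
    rw [show p + (y + 1) = p + y + 1 by ring, prod_Ico_succ_top (by omega), mul_comm (∏ q ∈ Ico p (p + y), Hg q) (Hg (p + y)), mul_assoc]
    exact (hgrow (p + y)).trans (mul_le_mul_of_nonneg_left ih (hH0 _))

/-- **THE YOUNG DROP FROM BELOW.**  One-lag young kernel `Ky ≥ 0`; `t` the zero-tailed solution of `t = v − Ry t` with `0 ≤ t ≤ v`; growth `v (p+1) ≤ Hg p·v p`.
Then `Ky (m+1) 0·(1 − Ky (m+2) 0·Hg (m+2))·v (m+2) ≤ Ry t (m+1)` (`t (m+2) ≥ v (m+2) − Ky (m+2) 0·v (m+3)`). [folklore] -/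
theorem young_drop_ge (hRy : ∀ v n, Ry v n = ∑ l ∈ range N, Ky n l * v (n + 1 + l)) (hKy : ∀ n l, 0 ≤ Ky n l)
    (hK1 : ∀ n l, 1 ≤ l → Ky n l = 0) (hN : 1 ≤ N) {v t Hg : ℕ → ℝ} (hrec : ∀ n, t n = v n - Ry t n) (htv : ∀ n, 0 ≤ t n ∧ t n ≤ v n)
    (hgrow : ∀ p, v (p + 1) ≤ Hg p * v p) (m : ℕ) :
    Ky (m + 1) 0 * (1 - Ky (m + 2) 0 * Hg (m + 2)) * v (m + 2) ≤ Ry t (m + 1) := by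
  rw [onelag_read hRy hK1 hN t (m + 1), show m + 1 + 1 = m + 2 by ring]
  have ht2 : t (m + 2) = v (m + 2) - Ky (m + 2) 0 * t (m + 3) := by rw [hrec (m + 2), onelag_read hRy hK1 hN t (m + 2)]
  have h1 : Ky (m + 2) 0 * t (m + 3) ≤ Ky (m + 2) 0 * (Hg (m + 2) * v (m + 2)) :=
    mul_le_mul_of_nonneg_left ((htv _).2.trans (hgrow (m + 2))) (hKy _ _)
  have h2 : (1 - Ky (m + 2) 0 * Hg (m + 2)) * v (m + 2) ≤ t (m + 2) := by nlinarith
  have := mul_le_mul_of_nonneg_left h2 (hKy (m + 1) 0)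
  linarith [this]

/-- **THE YOUNG DROP FROM ABOVE, ONE WINDOW DEEPER.**  Same setting, `Hg ≥ 0`: `Ry t (m+1+y) ≤ Ky (m+1+y) 0·(Π_{p∈[m+2,m+2+y)} Hg p)·v (m+2)`
(`t ≤ v` and the growth chained). [folklore] -/
theorem young_drop_le (hRy : ∀ v n, Ry v n = ∑ l ∈ range N, Ky n l * v (n + 1 + l)) (hKy : ∀ n l, 0 ≤ Ky n l)
    (hK1 : ∀ n l, 1 ≤ l → Ky n l = 0) (hN : 1 ≤ N) {v t Hg : ℕ → ℝ} (htv : ∀ n, 0 ≤ t n ∧ t n ≤ v n)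
    (hH0 : ∀ m, 0 ≤ Hg m) (hgrow : ∀ p, v (p + 1) ≤ Hg p * v p) (m y : ℕ) :
    Ry t (m + 1 + y) ≤ Ky (m + 1 + y) 0 * (∏ p ∈ Ico (m + 2) (m + 2 + y), Hg p) * v (m + 2) := by
  rw [onelag_read hRy hK1 hN t (m + 1 + y), mul_assoc, show m + 1 + y + 1 = m + 2 + y by ring]
  exact mul_le_mul_of_nonneg_left (((htv _).2).trans (growth_chain hH0 hgrow (m + 2) y)) (hKy _ _)

end OneLag

/-! ## §3 (MONO) for a pair (one-lag young age, old age) from the static decay inequality -/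

/-- **(MONO) FROM THE STATIC DECAY FAMILY (S-d).**  Lone kernels `KL ≥ 0` with reads `RL` on the horizon `N`; a ONE-LAG young age `i` (`KL i m l = 0` for
`l ≥ 1`) and an old age `k` with window `1 ≤ y ≤ N` (`KL k m l = 0` for `l ≥ y`) and shift domination inside its window; an old surplus `v ≥ 0` with KEY for
the young age (`RL i v ≤ v`), its zero-tailed young solution `t` (`t = v − RL i t`), and per-pin growth `v (p+1) ≤ Hg p·v p` with `Hg ≥ 0`.  IF at the pin `m`
**`KL k (m+1) (y−1)·KL i (m+1+y) 0·Π_{p∈[m+2,m+2+y)} Hg p ≤ KL k m 0·KL i (m+1) 0·(1 − KL i (m+2) 0·Hg (m+2))`** THEN the old read of the young drops does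
not increase from `m` to `m+1`: `RL k (RL i t) (m+1) ≤ RL k (RL i t) m`. [folklore] -/
theorem old_read_antitone_of_static_decay {N : ℕ} {KL : ℕ → ℕ → ℕ → ℝ} {RL : ℕ → (ℕ → ℝ) → ℕ → ℝ}
    (hRL : ∀ i v m, RL i v m = ∑ l ∈ range N, KL i m l * v (m + 1 + l)) (hKL : ∀ i m l, 0 ≤ KL i m l) (hN : 1 ≤ N)
    {i k y : ℕ} (hK1 : ∀ n l, 1 ≤ l → KL i n l = 0) (hKy : ∀ n l, y ≤ l → KL k n l = 0) (hy : 1 ≤ y) (hyN : y ≤ N)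
    (hshift : ∀ n l, l + 1 < y → KL k (n + 1) l ≤ KL k n (l + 1))
    {v t Hg : ℕ → ℝ} (hv0 : ∀ m, 0 ≤ v m) (hkey : ∀ m, RL i v m ≤ v m) (htail : ∀ m, N < m → t m = 0) (hrec : ∀ n, t n = v n - RL i t n)
    (hH0 : ∀ m, 0 ≤ Hg m) (hgrow : ∀ p, v (p + 1) ≤ Hg p * v p) {m : ℕ}
    (hSd : KL k (m + 1) (y - 1) * KL i (m + 1 + y) 0 * ∏ p ∈ Ico (m + 2) (m + 2 + y), Hg p ≤
      KL k m 0 * KL i (m + 1) 0 * (1 - KL i (m + 2) 0 * Hg (m + 2))) :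
    RL k (RL i t) (m + 1) ≤ RL k (RL i t) m := by
  have htv := sol_nonneg_le_of_supersol (hRL i) (hKL i) hv0 hkey htail hrec
  have hd0 : ∀ m', 0 ≤ RL i t m' := fun m' => read_nonneg (hRL i) (hKL i) fun n _ => (htv n).1
  refine read_antitone_of_entering_decay (hRL k) hKy hy hyN hshift hd0 ?_
  have hup := young_drop_le (hRL i) (hKL i) hK1 hN htv hH0 hgrow m y
  have hlow := young_drop_ge (hRL i) (hKL i) hK1 hN hrec htv hgrow m
  calc KL k (m + 1) (y - 1) * RL i t (m + 1 + y)
      ≤ KL k (m + 1) (y - 1) * (KL i (m + 1 + y) 0 * (∏ p ∈ Ico (m + 2) (m + 2 + y), Hg p) * v (m + 2)) :=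
        mul_le_mul_of_nonneg_left hup (hKL _ _ _)
    _ = (KL k (m + 1) (y - 1) * KL i (m + 1 + y) 0 * ∏ p ∈ Ico (m + 2) (m + 2 + y), Hg p) * v (m + 2) := by ring
    _ ≤ (KL k m 0 * KL i (m + 1) 0 * (1 - KL i (m + 2) 0 * Hg (m + 2))) * v (m + 2) := mul_le_mul_of_nonneg_right hSd (hv0 _)
    _ = KL k m 0 * (KL i (m + 1) 0 * (1 - KL i (m + 2) 0 * Hg (m + 2)) * v (m + 2)) := by ring
    _ ≤ KL k m 0 * RL i t (m + 1) := mul_le_mul_of_nonneg_left hlow (hKL _ _ _)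

end Summit.QuantumFields.BalabanUV.Beta.EriceRemainderEnclosureHistoryAutonomyComparisonAgeCompositionDecayRoute

end
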